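import Literature.Analysis.ValidatedNumerics.FixedPointInterval
import HarnessLib

/-!
# FIXED-POINT SLOPE ARITHMETIC for straight-line rational programs in the five σ variables, with a 5-D bisection driver —
# the range-bounding device for certified WINDOWS of σ-model quantities over typed boxes (INFL-3to1-B §B.101)

Venture CertifiedManyBodySolver, cell `pub/hubbard-downfold` (stage S1; INFLATION-RULES-3to1-B §B.101), seat hubbard-downfold-mod-4 (technique B = band
level, g45); namespace `Summit.Ventures.CertifiedManyBodySolver.Downfold.Emery`. Everything PROVED (0 sorry; pure algebra + the inclusion property of the
tree's fixed-point intervals `FI`, scale `2^48`, `Literature.Analysis.ValidatedNumerics.FixedPointInterval`). WHAT THIS IS NOT: a statement about any material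
or about the σ model — a generic validated-numerics device; no number lives here.

WHY. Naive interval evaluation of the nodal 2-jet ratios of the σ band (`EmeryBandJet`: `t″_J/t_J`, `t′_J/t_J`) over a typed box blows up by the
dependency effect (width ×7 already on a box of side 0.01 — bisection does not terminate). The first-order SLOPE FORM (Krawczyk 1983 / Hansen) cures it:
for every node `f` of a program and a centre `c` of the box `B`, `f(θ) − f(c) = Σₖ Sₖ(θ)·(θₖ − cₖ)` with slope functions `Sₖ` built by the EXACT algebraic
rules `S[f ± g] = S[f] ± S[g]`, `S[f·g] = S[f]·g(θ) + f(c)·S[g]`, `S[f²] = S[f]·(f(θ) + f(c))`, `S[f/g] = (S[f]·g(c) − f(c)·S[g])/(g(θ)g(c))` — identities of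
commutative algebra, no analysis — so that `f(B) ⊆ f(c) + Σₖ Sₖ(B)·(Bₖ − cₖ)` (intersected with the naive enclosure); the dependency loss becomes second order.

* §1 `Pt5`, `Box5` (five `FI` coordinates), membership, integer-midpoint centre `Box5.cen`.
* §2 `RExpr` — one instruction of a straight-line program: variables `var k` (k = 0 … 4; ≥ 4 reads coordinate 4), integer constants, `ref n` (the value
  computed `n + 1` instructions earlier), `add / sub / mul / neg / sqr / div`; real semantics `RExpr.eval` (total real division) and `Prog.eval` (a program
  pushes each value on an environment stack); the interval semantics `RExpr.evalS` / `Prog.evalS` computing for each instruction an `SNode` = (enclosure over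
  `B`, enclosure at the centre, five slope enclosures), `none` when a divisor is not certified positive.
* §3–§4 (companion file `EmerySlopeArithSound`): SOUNDNESS `Prog.evalS_sound` / `Prog.mem_of_evalS` (for `θ ∈ B` every computed node encloses the real
  value at `θ`, the value at the centre, and admits real slopes in the slope enclosures with the exact identity above) and the bisection driver
  `Box5.deep` with `Box5.forall_of_deep`.

Consumers: `EmeryBandJetWindow` (the jet ratios as a `Prog`, the window leaf, the box theorems). Sources: interval arithmetic [folklore] (Moore 1966;
slope form: Krawczyk–Neumaier 1985, Hansen 1992 — used here only as exact algebraic identities proved in place).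
-/

namespace Summit.Ventures.CertifiedManyBodySolver.Downfold.Emery

open Literature.Analysis.ValidatedNumerics.Numerics

/-! ## §1 Points, boxes, centres -/

/-- A point of `ℝ⁵` (the σ variables `(Δ, t_pd, t_pp, t_pp′, ε)` in consumers). [folklore] -/
structure Pt5 where
  /-- coordinate 0 -/
  x0 : ℝ
  /-- coordinate 1 -/
  x1 : ℝ
  /-- coordinate 2 -/
  x2 : ℝ
  /-- coordinate 3 -/
  x3 : ℝ
  /-- coordinate 4 -/
  x4 : ℝ

/-- Coordinate `k` of a point (`k ≥ 4` reads coordinate 4). [folklore] -/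
noncomputable def Pt5.get (p : Pt5) : ℕ → ℝ
  | 0 => p.x0
  | 1 => p.x1
  | 2 => p.x2
  | 3 => p.x3
  | _ => p.x4

/-- A box of `ℝ⁵` with fixed-point interval coordinates. [folklore] -/
structure Box5 where
  /-- coordinate 0 -/
  I0 : FI
  /-- coordinate 1 -/
  I1 : FI
  /-- coordinate 2 -/
  I2 : FI
  /-- coordinate 3 -/
  I3 : FI
  /-- coordinate 4 -/
  I4 : FI

namespace Box5

/-- Coordinate `k` of a box (`k ≥ 4` reads coordinate 4). [folklore] -/
def get (B : Box5) : ℕ → FI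
  | 0 => B.I0
  | 1 => B.I1
  | 2 => B.I2
  | 3 => B.I3
  | _ => B.I4

/-- Membership of a point in a box. [folklore] -/
def mem (B : Box5) (p : Pt5) : Prop :=
  FI.mem p.x0 B.I0 ∧ FI.mem p.x1 B.I1 ∧ FI.mem p.x2 B.I2 ∧ FI.mem p.x3 B.I3 ∧ FI.mem p.x4 B.I4

/-- Coordinatewise membership. [folklore] -/
theorem mem_get {B : Box5} {p : Pt5} (h : B.mem p) (k : ℕ) : FI.mem (p.get k) (B.get k) := by
  obtain ⟨h0, h1, h2, h3, h4⟩ := h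
  match k with
  | 0 => exact h0
  | 1 => exact h1
  | 2 => exact h2
  | 3 => exact h3
  | _ + 4 => exact h4

/-- The thin interval at the integer midpoint of an `FI`. [folklore] -/
def midFI (I : FI) : FI := ⟨(I.lo + I.hi) / 2, (I.lo + I.hi) / 2⟩

/-- The centre box (thin in every coordinate). [folklore] -/
def cen (B : Box5) : Box5 := ⟨midFI B.I0, midFI B.I1, midFI B.I2, midFI B.I3, midFI B.I4⟩

/-- The centre point (the scaled integer midpoints). [folklore] -/
noncomputable def cpt (B : Box5) : Pt5 :=
  ⟨(((B.I0.lo + B.I0.hi) / 2 : ℤ) : ℝ) / SC, (((B.I1.lo + B.I1.hi) / 2 : ℤ) : ℝ) / SC, (((B.I2.lo + B.I2.hi) / 2 : ℤ) : ℝ) / SC,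
    (((B.I3.lo + B.I3.hi) / 2 : ℤ) : ℝ) / SC, (((B.I4.lo + B.I4.hi) / 2 : ℤ) : ℝ) / SC⟩

/-- The centre point lies in the centre box. [folklore] -/
theorem mem_cpt (B : Box5) : B.cen.mem B.cpt :=
  ⟨FI.mem_ofScaled _, FI.mem_ofScaled _, FI.mem_ofScaled _, FI.mem_ofScaled _, FI.mem_ofScaled _⟩

end Box5

/-- Intersection of two `FI`s (sound for a real lying in both). [folklore] -/
def fiInter (I J : FI) : FI := ⟨max I.lo J.lo, min I.hi J.hi⟩

/-- [folklore] -/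
theorem mem_fiInter {x : ℝ} {I J : FI} (hI : FI.mem x I) (hJ : FI.mem x J) : FI.mem x (fiInter I J) := by
  simp only [FI.mem, fiInter, Int.cast_max, Int.cast_min] at hI hJ ⊢
  exact ⟨max_le hI.1 hJ.1, le_min hI.2 hJ.2⟩

/-! ## §2 Programs, real and interval semantics -/

/-- One instruction of a straight-line rational program in five variables. `ref n` reads the value computed `n + 1` instructions earlier
(the `n`-th entry of the environment stack). [folklore] -/
inductive RExpr where
  | var : ℕ → RExpr
  | const : ℤ → RExpr
  | ref : ℕ → RExpr
  | add : RExpr → RExpr → RExpr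
  | sub : RExpr → RExpr → RExpr
  | mul : RExpr → RExpr → RExpr
  | neg : RExpr → RExpr
  | sqr : RExpr → RExpr
  | div : RExpr → RExpr → RExpr

/-- A straight-line program: instructions executed head first, each value pushed on the environment stack. [folklore] -/
abbrev Prog := List RExpr

/-- Stack lookup with default. [folklore] -/
def envGet {α : Type} (d : α) : List α → ℕ → α
  | [], _ => d
  | x :: _, 0 => x
  | _ :: l, n + 1 => envGet d l n

/-- Real semantics of an instruction (total real division). [folklore] -/
noncomputable def RExpr.eval (p : Pt5) (env : List ℝ) : RExpr → ℝ
  | .var k => p.get k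
  | .const z => (z : ℝ)
  | .ref n => envGet 0 env n
  | .add f g => f.eval p env + g.eval p env
  | .sub f g => f.eval p env - g.eval p env
  | .mul f g => f.eval p env * g.eval p env
  | .neg f => -f.eval p env
  | .sqr f => f.eval p env ^ 2
  | .div f g => f.eval p env / g.eval p env

/-- Real semantics of a program: the final environment stack (last value on top). [folklore] -/
noncomputable def Prog.eval (p : Pt5) : List ℝ → Prog → List ℝ
  | env, [] => env
  | env, f :: rest => Prog.eval p (f.eval p env :: env) rest

/-- An enclosure node: value over the box, value at the centre, five slopes over the box. [folklore] -/
structure SNode where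
  /-- enclosure of `f(θ)`, `θ ∈ B` -/
  val : FI
  /-- enclosure of `f(c)` -/
  cen : FI
  /-- slope enclosure, coordinate 0 -/
  s0 : FI
  /-- slope enclosure, coordinate 1 -/
  s1 : FI
  /-- slope enclosure, coordinate 2 -/
  s2 : FI
  /-- slope enclosure, coordinate 3 -/
  s3 : FI
  /-- slope enclosure, coordinate 4 -/
  s4 : FI

/-- The zero interval. [folklore] -/
def fiZero : FI := ⟨0, 0⟩

/-- The interval `[1, 1]`. [folklore] -/
def fiOne : FI := ⟨SC, SC⟩

/-- The node of the constant `0` (default of the environment stack). [folklore] -/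
def SNode.zero : SNode := ⟨fiZero, fiZero, fiZero, fiZero, fiZero, fiZero, fiZero⟩

/-- Unit slope vector entry. [folklore] -/
def kron (i k : ℕ) : FI := if i = k then fiOne else fiZero

/-- The first-order range `cen + Σₖ sₖ·(Bₖ − Cₖ)`. [folklore] -/
def rangeOf (cen s0 s1 s2 s3 s4 : FI) (B C : Box5) : FI :=
  cen.add ((s0.mul (B.I0.sub C.I0)).add ((s1.mul (B.I1.sub C.I1)).add ((s2.mul (B.I2.sub C.I2)).add
    ((s3.mul (B.I3.sub C.I3)).add (s4.mul (B.I4.sub C.I4))))))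

/-- Assemble a node from centre value and slopes, intersecting the naive enclosure with the first-order range. [folklore] -/
def mkNode (naive cen s0 s1 s2 s3 s4 : FI) (B C : Box5) : SNode :=
  ⟨fiInter naive (rangeOf cen s0 s1 s2 s3 s4 B C), cen, s0, s1, s2, s3, s4⟩

/-- Node of a variable (`k ≥ 4` is coordinate 4). [folklore] -/
def varNode (B C : Box5) (k : ℕ) : SNode :=
  let k' := min k 4
  ⟨B.get k, C.get k, kron 0 k', kron 1 k', kron 2 k', kron 3 k', kron 4 k'⟩

/-- Node of `f + g`. [folklore] -/
def addNode (F G : SNode) (B C : Box5) : SNode :=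
  mkNode (F.val.add G.val) (F.cen.add G.cen) (F.s0.add G.s0) (F.s1.add G.s1) (F.s2.add G.s2) (F.s3.add G.s3) (F.s4.add G.s4) B C

/-- Node of `f − g`. [folklore] -/
def subNode (F G : SNode) (B C : Box5) : SNode :=
  mkNode (F.val.sub G.val) (F.cen.sub G.cen) (F.s0.sub G.s0) (F.s1.sub G.s1) (F.s2.sub G.s2) (F.s3.sub G.s3) (F.s4.sub G.s4) B C

/-- Node of `f · g`: slopes `S[f]·g(B) + f(c)·S[g]`. [folklore] -/
def mulNode (F G : SNode) (B C : Box5) : SNode :=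
  mkNode (F.val.mul G.val) (F.cen.mul G.cen) ((F.s0.mul G.val).add (F.cen.mul G.s0)) ((F.s1.mul G.val).add (F.cen.mul G.s1))
    ((F.s2.mul G.val).add (F.cen.mul G.s2)) ((F.s3.mul G.val).add (F.cen.mul G.s3)) ((F.s4.mul G.val).add (F.cen.mul G.s4)) B C

/-- Node of `−f`. [folklore] -/
def negNode (F : SNode) : SNode := ⟨F.val.neg, F.cen.neg, F.s0.neg, F.s1.neg, F.s2.neg, F.s3.neg, F.s4.neg⟩

/-- Node of `f²`: slopes `S[f]·(f(B) + f(c))`. [folklore] -/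
def sqrNode (F : SNode) (B C : Box5) : SNode :=
  let w := F.val.add F.cen
  mkNode F.val.sqr F.cen.sqr (F.s0.mul w) (F.s1.mul w) (F.s2.mul w) (F.s3.mul w) (F.s4.mul w) B C

/-- Node of `f / g` for a divisor certified positive on the box and at the centre: slopes `(S[f]·g(c) − f(c)·S[g]) / (g(B)·g(c))`. [folklore] -/
def divNode (F G : SNode) (B C : Box5) : Option SNode :=
  if 0 < G.val.lo ∧ 0 < G.cen.lo then
    match FI.divPos F.val G.val, FI.divPos F.cen G.cen,
      FI.divPos ((F.s0.mul G.cen).sub (F.cen.mul G.s0)) (G.val.mul G.cen), FI.divPos ((F.s1.mul G.cen).sub (F.cen.mul G.s1)) (G.val.mul G.cen),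
      FI.divPos ((F.s2.mul G.cen).sub (F.cen.mul G.s2)) (G.val.mul G.cen), FI.divPos ((F.s3.mul G.cen).sub (F.cen.mul G.s3)) (G.val.mul G.cen),
      FI.divPos ((F.s4.mul G.cen).sub (F.cen.mul G.s4)) (G.val.mul G.cen) with
    | some q, some qc, some t0, some t1, some t2, some t3, some t4 => some (mkNode q qc t0 t1 t2 t3 t4 B C)
    | _, _, _, _, _, _, _ => none
  else none

/-- Interval semantics of an instruction. [folklore] -/
def RExpr.evalS (B C : Box5) (env : List SNode) : RExpr → Option SNode
  | .var k => some (varNode B C k)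
  | .const z => some ⟨FI.ofInt z, FI.ofInt z, fiZero, fiZero, fiZero, fiZero, fiZero⟩
  | .ref n => some (envGet SNode.zero env n)
  | .add f g =>
    match f.evalS B C env, g.evalS B C env with
    | some F, some G => some (addNode F G B C)
    | _, _ => none
  | .sub f g =>
    match f.evalS B C env, g.evalS B C env with
    | some F, some G => some (subNode F G B C)
    | _, _ => none
  | .mul f g =>
    match f.evalS B C env, g.evalS B C env with
    | some F, some G => some (mulNode F G B C)
    | _, _ => none
  | .neg f =>
    match f.evalS B C env with
    | some F => some (negNode F)
    | none => none
  | .sqr f =>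
    match f.evalS B C env with
    | some F => some (sqrNode F B C)
    | none => none
  | .div f g =>
    match f.evalS B C env, g.evalS B C env with
    | some F, some G => divNode F G B C
    | _, _ => none

/-- Interval semantics of a program: the final stack of nodes, `none` if any instruction fails. [folklore] -/
def Prog.evalS (B C : Box5) : List SNode → Prog → Option (List SNode)
  | env, [] => some env
  | env, f :: rest =>
    match f.evalS B C env with
    | some N => Prog.evalS B C (N :: env) rest
    | none => none

end Summit.Ventures.CertifiedManyBodySolver.Downfold.Emery
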